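import Summits.ResolutionOfSingularities.ResolutionOfSingularities.Theorems.WildConesCampaignW46ForcedAtomFiniteStep
import HarnessLib

/-!
# [OURS · L1 W4.6, rung (i)/(all `n ≥ 1`)] The forced-atom rung over every PERFECT field, for `K`-RATIONAL singular
# points: no infinite §2.1-permissible sequence (résumé-free and typed)
# (cell res-hironaka, LADDER-RESOLUTION rung L, D-0089; slot W4.6, seat res-L1-s46-pv-2 gen 3; host route `WildCones`,
# crux `ClassicalRegimes` stmt-ResolutionOfSingularities-16884, `--supports … --as helper`)

HONEST FRAMING. Everything here is OURS. NOTHING below is a statement of H. Hironaka's manuscript [Hironaka2017] and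
nothing asserts that any statement of it holds: the typed procedure and its résumé-free form (`CampaignW46.Run`/`Terminates`
— res-L1-type-o1; `PermissibleRun`/`PermissiblyTerminates` — res-L1-s46-pv-1), o1's regime `Regime.forcedAtom` (p517839)
and the typed candidate carriers of row 001 enter as DEFINITIONS; no FACT-LIST premise is used. AI review is weaker than
expert review.

## What is proved — the GENERAL FIELD form of the forced-atom rung (antitone, definition-free)

Over an arbitrary PERFECT field `K` of characteristic `p` the one step of this seat's dictionary needs exactly one extra
input: the next singular point is rational over the current one (brick 17, `exists_presentation_transform_of_rat`). This
holds as soon as the singular points are `K`-RATIONAL — every germ at the point is congruent modulo `𝔪` to a constant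
(`sectionConst`, the tree's constants of a scheme over `Spec K`): `exists_sub_stalkMap_mem_maximalIdeal_of_kRational`
(pull-back of constants along a morphism over `Spec K`, `stalkMap_germ_appLE` / `appLE_sectionConst`). Hence:

* `permissiblyTerminates_of_le_forcedAtomRational (hn : 0 < n) (Rg) (hRg)` — for EVERY regime `Rg` contained in
  «`Regime.forcedAtom n` AND every singular point is `K`-rational»: no infinite §2.1-permissible sequence inside `Rg`;
  `terminates_of_le_forcedAtomRational` — `Terminates N Rd Rg` for every `N`, `Rd` (and the ∇-centred form).

This subsumes the algebraically closed case (p523688: every closed point is rational, brick 7′) and the finite case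
(p528213: rationality automatic in the regime, brick 16) as far as the HYPOTHESIS goes, and is the natural statement over
an infinite perfect non-closed `K`, where o1's regime alone does not force rationality (a field may be ring-isomorphic to a
proper finite extension of itself). The Milnor exit bound in this form is `…ForcedAtomRationalExitBound.lean`.
NOT claimed: non-rational singular points over infinite non-closed perfect `K`; `n = 0`. References: p523688 (proof repeated
verbatim with the new one step), bricks 7′/16/17, res-L1-s46-pv-1 p469934, res-L1-type-o1 p517839. [folklore]
-/

noncomputable section

-- single-problem summit: the doubled namespace component `ResolutionOfSingularities` is forced
set_option linter.dupNamespace false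

open scoped BigOperators Classical
open MvPowerSeries IsLocalRing

namespace Summit.ResolutionOfSingularities.ResolutionOfSingularities.Theorems

namespace CampaignW46.ForcedAtom

open CategoryTheory AlgebraicGeometry TopologicalSpace
open Literature.AlgebraicGeometry.Resolution
open Literature.AlgebraicGeometry.Hironaka2017.S02Preliminaries
open Literature.AlgebraicGeometry.Hironaka2017.Datum
open Scheme.IdealSheafData
open WildCones
open CampaignW46.AtomGerm

variable {p : ℕ} [Fact p.Prime] {K : Type} [Field K] [CharP K p] {n : ℕ}

/-! ## `K`-rational points are rational over their images -/

omit [Fact p.Prime] [CharP K p] in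
/-- **A `K`-rational point is rational over its image**: for a morphism `π : Z′ → Z` over `Spec K` (`q′ = π ≫ q`) and a
point `ξ′` of `Z′` at which every germ is congruent modulo `𝔪_{ξ′}` to a constant of `K`, every germ at `ξ′` is congruent to
the pull-back of a germ at `π ξ′` (namely of the same constant). [folklore] -/
theorem exists_sub_stalkMap_mem_maximalIdeal_of_kRational {Z Z' : Scheme.{0}} (π : Z' ⟶ Z) (q : Z ⟶ Spec (.of K))
    (q' : Z' ⟶ Spec (.of K)) (hq : q' = π ≫ q) (ξ' : Z')
    (hratK : ∀ y : Z'.presheaf.stalk ξ', ∃ l : K,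
      y - (Z'.presheaf.germ ⊤ ξ' trivial).hom (sectionConst q' ⊤ l) ∈ maximalIdeal (Z'.presheaf.stalk ξ'))
    (y : Z'.presheaf.stalk ξ') :
    ∃ x : Z.presheaf.stalk (π ξ'), y - (π.stalkMap ξ').hom x ∈ maximalIdeal (Z'.presheaf.stalk ξ') := by
  obtain ⟨l, hl⟩ := hratK y
  have hVU : (⊤ : Z'.Opens) ≤ π ⁻¹ᵁ (⊤ : Z.Opens) := fun _ _ => trivial
  refine ⟨(Z.presheaf.germ ⊤ (π ξ') trivial).hom (sectionConst q ⊤ l), ?_⟩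
  rw [stalkMap_germ_appLE π hVU (Set.mem_univ ξ'), appLE_sectionConst, ← hq]
  exact hl

/-! ## No infinite permissible sequence in a `K`-rational forced-atom regime -/

variable [PerfectField K]

/-- [OURS · L1 W4.6, rung (i) for surfaces (`n = 1`), (ii)-type for all `n ≥ 1`, over every PERFECT field — RÉSUMÉ-FREE,
antitone; replaces the role of the termination clause of Th. 16.13 p.87 l.25–28 of H. Hironaka's ms. (2017) read on
§2.1-permissible sequences restricted to the `K`-rational forced-atom class; NOT a statement of the manuscript] **Over a
perfect field `K` of characteristic `p`, `0 < n`: a regime contained in `Regime.forcedAtom n` all of whose singular points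
are `K`-rational admits no infinite §2.1-permissible sequence.** [folklore] -/
theorem permissiblyTerminates_of_le_forcedAtomRational (hn : 0 < n) (Rg : Regime p K)
    (hRg : ∀ (A : AmbientDatum p K) (E : IdealExponent A.Z), Rg A E →
      Regime.forcedAtom (p := p) (K := K) n A E ∧ ∀ ξ ∈ E.sing, ∀ y : A.Z.presheaf.stalk ξ, ∃ l : K,
          y - (A.Z.presheaf.germ ⊤ ξ trivial).hom (sectionConst A.hom ⊤ l) ∈ maximalIdeal (A.Z.presheaf.stalk ξ)) :
    PermissiblyTerminates Rg := by
  intro r hr'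
  have hp : p.Prime := Fact.out
  have hr : ∀ k, Regime.forcedAtom (p := p) (K := K) n (r.A k) (r.E k) := fun k => (hRg _ _ (hr' k)).1
  have hS : ∀ k, (r.E k).sing.Subsingleton := fun k => (hr k).2.1
  -- in the regime every permissible centre is the singular point
  have hcen : ∀ k, ∃ ξ : (r.A k).Z, (r.D k : Set (r.A k).Z) = {ξ} ∧ (r.E k).sing = {ξ} := by
    intro k
    obtain ⟨ξ, hξD⟩ := (r.permissible k).irreducible.nonempty
    have hξS : ξ ∈ (r.E k).sing := (r.permissible k).subset_sing hξD
    refine ⟨ξ, ?_, (hS k).eq_singleton_of_mem hξS⟩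
    exact (Set.subsingleton_of_subset_singleton
      (((hS k).eq_singleton_of_mem hξS) ▸ (r.permissible k).subset_sing)).eq_singleton_of_mem hξD
  choose ξ hξ using hcen
  have hξS : ∀ k, ξ k ∈ (r.E k).sing := fun k => by
    rw [(hξ k).2]
    exact Set.mem_singleton _
  -- every singular point is `K`-rational, hence rational over the previous one
  have hrat : ∀ k (y : (r.A (k + 1)).Z.presheaf.stalk (ξ (k + 1))), ∃ x : (r.A k).Z.presheaf.stalk (r.π k (ξ (k + 1))),
      y - ((r.π k).stalkMap (ξ (k + 1))).hom x ∈ maximalIdeal ((r.A (k + 1)).Z.presheaf.stalk (ξ (k + 1))) :=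
    fun k => exists_sub_stalkMap_mem_maximalIdeal_of_kRational (r.π k) (r.A k).hom (r.A (k + 1)).hom (r.hom_eq k)
      (ξ (k + 1)) ((hRg _ _ (hr' (k + 1))).2 (ξ (k + 1)) (hξS (k + 1)))
  -- multiplicity `p` of a presented atom is read off `ξ_k ∈ Sing(E_k)` (and `ser ≠ 0` off isolatedness)
  have hmult : ∀ (k : ℕ)
      (E₀ : AdicCompletion (maximalIdeal ((r.A k).Z.presheaf.stalk (ξ k))) ((r.A k).Z.presheaf.stalk (ξ k)) ≃+*
        MvPowerSeries (Option (Fin n)) K)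
      (f₀ : (r.A k).Z.presheaf.stalk (ξ k)) (a : (Fin n → ℕ) → K) (w : MvPowerSeries (Option (Fin n)) K),
      stalkIdeal (r.E k).J (ξ k) = Ideal.span {f₀} → IsUnit w →
        E₀ (algebraMap _ _ f₀) = w * ((X none : MvPowerSeries (Option (Fin n)) K) ^ p -
          rename (some : Fin n → Option (Fin n)) (ser p n K a)) → MultP p n K a := by
    intro k E₀ f₀ a w hJ hw hf₀
    haveI : IsRegularLocalRing ((r.A k).Z.presheaf.stalk (ξ k)) := ambient_isRegular (r.A k) _
    have hI : Isol p n K a := ((hr k).2.2 (ξ k) (hξS k)).2.2 E₀ f₀ a w hJ hw hf₀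
    have hf₀𝔪 : f₀ ∈ maximalIdeal ((r.A k).Z.presheaf.stalk (ξ k)) ^ p := by
      have h := hξS k
      change ((r.E k).b : ℕ∞) ≤ idealOrder (r.E k).J _ at h
      rw [le_idealOrder_iff, hJ, Ideal.span_singleton_le_iff_mem, (hr k).1] at h
      exact h
    exact (transform_mem_pow_iff_multP E₀ hw a hf₀).2.mpr ⟨ThreefoldsCharTwo.ser_ne_zero_of_isol hn hI, hf₀𝔪⟩
  -- presentations at `ξ_k`, and the one-step transition
  let P : ℕ → Type := fun k =>
    Σ' (E₀ : AdicCompletion (maximalIdeal ((r.A k).Z.presheaf.stalk (ξ k))) ((r.A k).Z.presheaf.stalk (ξ k)) ≃+*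
        MvPowerSeries (Option (Fin n)) K)
      (f₀ : (r.A k).Z.presheaf.stalk (ξ k)) (a : (Fin n → ℕ) → K) (w : MvPowerSeries (Option (Fin n)) K),
      stalkIdeal (r.E k).J (ξ k) = Ideal.span {f₀} ∧ IsUnit w ∧
        E₀ (algebraMap _ _ f₀) = w * ((X none : MvPowerSeries (Option (Fin n)) K) ^ p -
          rename (some : Fin n → Option (Fin n)) (ser p n K a))
  have hnext : ∀ (k : ℕ) (q : P k), ∃ (i₀ : Fin n) (t : Fin n → K) (q' : P (k + 1)),
      q'.2.2.1 = step p n K i₀ t q.2.2.1 := by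
    intro k q
    obtain ⟨E₀, f₀, a, w, hJ, hw, hf₀⟩ := q
    have hd := ((hr k).2.2 (ξ k) (hξS k)).1
    have hξ' : ξ (k + 1) ∈ ((r.E k).transform (r.π k) (r.D k)).sing := by
      rw [← r.E_succ k]
      exact hξS (k + 1)
    obtain ⟨i₀, t, E₀', f₀', w', hJ', hw', hf₀'⟩ := exists_presentation_transform_of_rat (r.π k) (r.D k)
      (r.blowup k) (hr k).1 (hS k) (hξS k) (hξ k).1 hd E₀ f₀ a w hJ hw hf₀
      (hmult k E₀ f₀ a w hJ hw hf₀) hξ' (hrat k)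
    refine ⟨i₀, t, ⟨E₀', f₀', step p n K i₀ t a, w', ?_, hw', hf₀'⟩, rfl⟩
    rw [r.E_succ k]
    exact hJ'
  choose inext tnext qnext hnext using hnext
  -- the initial presentation and the induced sequence of presentations
  obtain ⟨E₀, f₀, c₀, w₀, hJ0, hw0, hf0⟩ := ((hr 0).2.2 (ξ 0) (hξS 0)).2.1
  let q0 : P 0 := ⟨E₀, f₀, c₀, w₀, hJ0, hw0, hf0⟩
  let sq : ∀ k, P k := fun k => Nat.rec (motive := fun k => P k) q0 (fun k q => qnext k q) k
  have hsq : ∀ k, sq (k + 1) = qnext k (sq k) := fun k => rfl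
  -- the induced run of the coefficient calculus
  have hrun : ∀ k, run p n K c₀ (fun k => inext k (sq k)) (fun k => tnext k (sq k)) k = (sq k).2.2.1 := by
    intro k
    induction k with
    | zero => rfl
    | succ k ih =>
      rw [hsq, hnext k (sq k), ← ih]
      rfl
  -- every state is isolated of multiplicity `p`: contradiction with the proved target of `WildCones`
  have hnot : ¬ InfRun p n K c₀ (fun k => inext k (sq k)) (fun k => tnext k (sq k)) :=
    IsolatedForcedTermination_proof p hp n hn K c₀ _ _
  refine hnot fun k => ?_
  rw [hrun k]
  obtain ⟨E₀, f₀, a, w, hJ, hw, hf₀⟩ := sq k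
  exact ⟨((hr k).2.2 (ξ k) (hξS k)).2.2 E₀ f₀ a w hJ hw hf₀, hmult k E₀ f₀ a w hJ hw hf₀⟩

/-- [OURS · L1 W4.6; NOT a statement of the manuscript] The typed rungs from the résumé-free one: `Terminates N Rd Rg` and
`TerminatesNabla N Rd Rg` for every notion instance and reading, for every `K`-rational forced-atom regime `Rg` over a perfect
field (`0 < n`). [folklore] -/
theorem terminates_of_le_forcedAtomRational (hn : 0 < n) {m : ℕ} (N : Notions.{0} m) (Rd : Reading p K N) (Rg : Regime p K)
    (hRg : ∀ (A : AmbientDatum p K) (E : IdealExponent A.Z), Rg A E →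
      Regime.forcedAtom (p := p) (K := K) n A E ∧ ∀ ξ ∈ E.sing, ∀ y : A.Z.presheaf.stalk ξ, ∃ l : K,
          y - (A.Z.presheaf.germ ⊤ ξ trivial).hom (sectionConst A.hom ⊤ l) ∈ maximalIdeal (A.Z.presheaf.stalk ξ)) :
    Terminates N Rd Rg ∧ TerminatesNabla N Rd Rg :=
  have h := terminates_of_permissiblyTerminates N Rd (permissiblyTerminates_of_le_forcedAtomRational hn Rg hRg)
  ⟨h, terminatesNabla_of_terminates h⟩

end CampaignW46.ForcedAtom

end Summit.ResolutionOfSingularities.ResolutionOfSingularities.Theorems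

end
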